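import Literature.NumberTheory.NumberFields.KummerCubeRootUnramifiedConverse
import Mathlib.Algebra.CharP.Lemmas
import Mathlib.Algebra.CharP.Reduced
import HarnessLib

/-!
# If `H(ᵖ√u)/H` is unramified at a prime `𝔓` with `p ∈ 𝔓^{p−1}`, then `u` is a `p`-th power modulo `𝔓ᵖ`
# (Hecke, *Lectures on the Theory of Algebraic Numbers*, §39, Thm 119 — necessity half, any prime `ℓ = p`)

Topic `NumberTheory/NumberFields`.  Theorem-only file (no definition, no named fact), the analogue for an
arbitrary prime `p` of `KummerCubeRootUnramifiedConverse.lean` (`p = 3`) and the converse companion of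
`KummerPthRootUnramified.lean` (sufficiency: `β ≡ α^p (mod λ^p)`, `λ^{p−1} ∼ p` ⇒ `H(ᵖ√β)/H` unramified).

Hecke, *Lectures on the Theory of Algebraic Numbers* (GTM 77), §39, Thm 119, for `k ∋ ζ = ζ_ℓ`, a prime
`𝔩 ∣ ℓ` with `𝔩^a ‖ (1 − ζ)` and `μ` prime to `𝔩`: in `K = k(ℓ√μ)` the prime `𝔩` "becomes the `ℓ`th
power of a prime ideal" if the congruence `μ ≡ ξ^ℓ (mod 𝔩^{aℓ})` (83) is unsolvable; i.e.
(contrapositive) **if `𝔩` is unramified in `k(ℓ√μ)` then `μ ≡ ξ^ℓ (mod 𝔩^{aℓ})` is solvable**.  Here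
`ℓ = p` is any prime and `a = 1` in the weak form `p ∈ 𝔓^{p−1}` (i.e. `e(𝔓 ∣ p) ≥ p − 1`, which is what
`a ≥ 1` gives: `(1 − ζ)^{p−1} ∼ p`), modulus `𝔓^p` — for `k = ℚ(ζ_p)`, `𝔓 = (1 − ζ_p)`, exactly Hecke's
`𝔩^{aℓ} = (1 − ζ_p)^p`, the modulus of Kummer's lemma (`KummersLemma.lean`).

The proof is the standard local computation (Washington, *Introduction to Cyclotomic Fields*, Exercise 9.3;
as in the tree's `p = 3` file): let `𝔔 ∣ 𝔓` in `E = H(y)`, `y^p = u`.  The residue field `𝓞_H/𝔓` is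
finite of characteristic `p`, so the Frobenius `x ↦ x^p` is a bijection on it and `u ≡ ξ^p (mod 𝔓)` for
some `ξ ∈ 𝓞_H`; Frobenius is injective on the field `𝓞_E/𝔔`, so `y ≡ ξ (mod 𝔔)`; then

  `u − ξ^p = y^p − ξ^p = (y − ξ)^p + p(y − ξ)ξ·r ∈ 𝔔^p`   (as `p ∈ 𝔓^{p−1} ⊆ 𝔔^{p−1}`),

and if `e(𝔔 ∣ 𝔓) = 1` then `𝔔^p ∩ 𝓞_H = 𝔓^p`
(`mem_pow_iff_algebraMap_mem_pow_of_ramificationIdx_eq_one` of the `p = 3` file).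

## Main statements

* `exists_pow_prime_sub_mem_of_mem`, `sub_mem_of_pow_prime_sub_pow_prime_mem` — `p`-th roots exist and
  are unique in residue rings of characteristic `p` (Frobenius on `R/𝔓`);
* `pow_prime_sub_pow_prime_mem_pow` — `y ≡ ξ (mod 𝔔)`, `p ∈ 𝔔^{p−1}` ⇒ `y^p ≡ ξ^p (mod 𝔔^p)`;
* `exists_sub_pow_prime_mem_pow_of_ramificationIdx_eq_one`, `…_of_isUnramifiedAt`,
  `…_of_isUnramifiedIn` — **Hecke's necessary condition**: for number fields `H ⊆ E`, `u ∈ 𝓞_H`,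
  `y ∈ 𝓞_E` with `y^p = u`, a prime `𝔓` of `𝓞_H` with `p ∈ 𝔓^{p−1}` and a prime `𝔔 ∣ 𝔓` of `𝓞_E`
  unramified over `𝓞_H`: `u ≡ ξ^p (mod 𝔓^p)` for some `ξ ∈ 𝓞_H`;
* `pow_prime_mul_sub_one_sub_one_mem_pow`, `pow_sub_one_sub_one_mem_pow_of_sub_pow_prime_mem`,
  `sub_pow_prime_mem_pow_of_pow_sub_one` — the dictionary "`u ≡ ξ^p (mod 𝔓^p)` ⟺
  `u^{q−1} ≡ 1 (mod 𝔓^p)`" (`q = #𝓞_H/𝔓`, `u ∉ 𝔓`), which for `H = ℚ(ζ_p)`, `𝔓 = (1 − ζ_p)`, `q = p`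
  is Kummer's "`u^{p−1} ≡ 1 (mod λ^p)`".

## References

* E. Hecke, *Lectures on the Theory of Algebraic Numbers*, GTM 77, Springer (1981), §39 Thm 119.
  [Hecke1981]
* L. C. Washington, *Introduction to Cyclotomic Fields*, GTM 83, 2nd ed. (1997), Exercise 9.3, Thm 5.36.
  [Washington1997]
-/

noncomputable section

open NumberField Ideal

namespace Literature.NumberTheory.NumberFields

/-! ### `p`-th roots in rings of characteristic `p` -/

/-- Modulo a prime ideal `P` containing the prime `p` with finite residue ring, every element is a
`p`-th power: `∃ ξ, ξ^p ≡ u (mod P)` (Frobenius is injective on the domain `R/P`, hence bijective).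
[folklore] -/
private theorem exists_pow_prime_sub_mem_of_mem {R : Type*} [CommRing R] {p : ℕ} (hp : p.Prime)
    (P : Ideal R) [P.IsPrime] [Finite (R ⧸ P)] (hpP : (p : R) ∈ P) (u : R) :
    ∃ ξ : R, ξ ^ p - u ∈ P := by
  haveI : CharP (R ⧸ P) p := (CharP.charP_iff_prime_eq_zero hp).mpr
    (by rw [← map_natCast (Ideal.Quotient.mk P)]; exact Ideal.Quotient.eq_zero_iff_mem.mpr hpP)
  haveI := ExpChar.prime (R := R ⧸ P) hp
  have hinj : Function.Injective (frobenius (R ⧸ P) p) := frobenius_inj (R ⧸ P) p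
  obtain ⟨c, hc⟩ := Finite.surjective_of_injective hinj (Ideal.Quotient.mk P u)
  obtain ⟨ξ, rfl⟩ := Ideal.Quotient.mk_surjective c
  refine ⟨ξ, ?_⟩
  rw [← Ideal.Quotient.eq, map_pow]
  exact hc

/-- Modulo a prime ideal `Q` containing the prime `p`, `p`-th roots are unique: `y^p ≡ ξ^p (mod Q)`
forces `y ≡ ξ (mod Q)`. [folklore] -/
private theorem sub_mem_of_pow_prime_sub_pow_prime_mem {R : Type*} [CommRing R] {p : ℕ} (hp : p.Prime)
    (Q : Ideal R) [Q.IsPrime] (hpQ : (p : R) ∈ Q) {y ξ : R} (h : y ^ p - ξ ^ p ∈ Q) : y - ξ ∈ Q := by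
  haveI : CharP (R ⧸ Q) p := (CharP.charP_iff_prime_eq_zero hp).mpr
    (by rw [← map_natCast (Ideal.Quotient.mk Q)]; exact Ideal.Quotient.eq_zero_iff_mem.mpr hpQ)
  haveI := ExpChar.prime (R := R ⧸ Q) hp
  have hinj : Function.Injective (frobenius (R ⧸ Q) p) := frobenius_inj (R ⧸ Q) p
  rw [← Ideal.Quotient.eq]
  apply hinj
  rw [frobenius_def, frobenius_def, ← map_pow, ← map_pow]
  exact (Ideal.Quotient.eq).mpr h

/-! ### The `p`-th power of a congruence modulo `𝔔` holds modulo `𝔔ᵖ` when `p ∈ 𝔔^{p−1}` -/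

/-- If `p ∈ Q^{p−1}` and `y ≡ ξ (mod Q)` then `y^p ≡ ξ^p (mod Q^p)`:
`y^p − ξ^p = (y − ξ)^p + p (y − ξ) ξ r`. [folklore] -/
private theorem pow_prime_sub_pow_prime_mem_pow {R : Type*} [CommRing R] {p : ℕ} (hp : p.Prime)
    (Q : Ideal R) (hpQ : (p : R) ∈ Q ^ (p - 1)) {y ξ : R} (h : y - ξ ∈ Q) : y ^ p - ξ ^ p ∈ Q ^ p := by
  obtain ⟨r, hr⟩ := exists_add_pow_prime_eq hp (y - ξ) ξ
  rw [sub_add_cancel] at hr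
  have key : y ^ p - ξ ^ p = (y - ξ) ^ p + p * (y - ξ) * ξ * r := by rw [hr]; ring
  rw [key]
  refine (Q ^ p).add_mem (Ideal.pow_mem_pow h p) ?_
  refine Ideal.mul_mem_right _ _ (Ideal.mul_mem_right _ _ ?_)
  have := Ideal.mul_mem_mul hpQ h
  rwa [← pow_succ, Nat.sub_add_cancel hp.one_lt.le] at this

/-! ### Hecke's necessary condition at a prime `ℓ = p` -/

variable {H E : Type*} [Field H] [NumberField H] [Field E] [NumberField E] [Algebra H E]

/-- **Hecke, Thm 119 (necessity, any prime `ℓ = p`).**  Let `H ⊆ E` be number fields, `u ∈ 𝓞_H` and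
`y ∈ 𝓞_E` with `y^p = u`; let `𝔓` be a prime of `𝓞_H` with `p ∈ 𝔓^{p−1}` (e.g. any prime above `p`
of a field containing `ζ_p`), and `𝔔` a prime of `𝓞_E` above `𝔓` with `e(𝔔 ∣ 𝔓) = 1`.  Then `u` is
a `p`-th power modulo `𝔓^p`: `u − ξ^p ∈ 𝔓^p` for some `ξ ∈ 𝓞_H`.  (Contrapositive of "if (83) is
unsolvable then `𝔩` becomes an `ℓ`th power".) [cite: Hecke1981, §39 Thm 119] -/
theorem exists_sub_pow_prime_mem_pow_of_ramificationIdx_eq_one {p : ℕ} (hp : p.Prime) {u : 𝓞 H}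
    {y : 𝓞 E} (hy : y ^ p = algebraMap (𝓞 H) (𝓞 E) u) (𝔓 : Ideal (𝓞 H)) [𝔓.IsMaximal]
    (hp𝔓 : (p : 𝓞 H) ∈ 𝔓 ^ (p - 1)) (𝔔 : Ideal (𝓞 E)) [𝔔.IsMaximal] [𝔔.LiesOver 𝔓]
    (he : Ideal.ramificationIdx 𝔔 (𝓞 H) = 1) : ∃ ξ : 𝓞 H, u - ξ ^ p ∈ 𝔓 ^ p := by
  classical
  have hp1 : p - 1 ≠ 0 := by have := hp.two_le; omega
  -- `p ∈ 𝔓`, so `𝔓 ≠ ⊥`, `𝔔 ≠ ⊥`, and the residue field of `𝔓` is finite of characteristic `p`.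
  have hpP : (p : 𝓞 H) ∈ 𝔓 := Ideal.pow_le_self hp1 hp𝔓
  have hP0 : 𝔓 ≠ ⊥ := by
    intro h
    rw [h, Ideal.mem_bot] at hpP
    exact (Nat.cast_ne_zero.mpr hp.ne_zero) hpP
  have hQ0 : 𝔔 ≠ ⊥ := Ideal.ne_bot_of_liesOver_of_ne_bot hP0 𝔔
  haveI : Finite (𝓞 H ⧸ 𝔓) := Ring.HasFiniteQuotients.finiteQuotient hP0
  -- a `p`-th root of `u` modulo `𝔓`
  obtain ⟨ξ, hξ⟩ := exists_pow_prime_sub_mem_of_mem hp 𝔓 hpP u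
  refine ⟨ξ, ?_⟩
  -- `y ≡ ξ (mod 𝔔)` by uniqueness of `p`-th roots modulo `𝔔`
  have hle : Ideal.map (algebraMap (𝓞 H) (𝓞 E)) 𝔓 ≤ 𝔔 :=
    Ideal.map_le_iff_le_comap.mpr (le_of_eq (𝔔.over_def 𝔓))
  have hpQ : (p : 𝓞 E) ∈ 𝔔 := by
    have := Ideal.mem_map_of_mem (algebraMap (𝓞 H) (𝓞 E)) hpP
    rw [map_natCast] at this
    exact hle this
  have hpQ' : (p : 𝓞 E) ∈ 𝔔 ^ (p - 1) := by
    have := Ideal.mem_map_of_mem (algebraMap (𝓞 H) (𝓞 E)) hp𝔓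
    rw [map_natCast] at this
    have hle' : Ideal.map (algebraMap (𝓞 H) (𝓞 E)) (𝔓 ^ (p - 1)) ≤ 𝔔 ^ (p - 1) := by
      rw [Ideal.map_pow]
      exact Ideal.pow_right_mono hle _
    exact hle' this
  have hyξ : y - algebraMap (𝓞 H) (𝓞 E) ξ ∈ 𝔔 := by
    apply sub_mem_of_pow_prime_sub_pow_prime_mem hp 𝔔 hpQ
    rw [hy, ← map_pow, ← map_sub]
    have hmem : u - ξ ^ p ∈ 𝔓 := by
      have := 𝔓.neg_mem hξ
      rwa [neg_sub] at this
    exact hle (Ideal.mem_map_of_mem _ hmem)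
  -- hence `u − ξ^p = y^p − ξ^p ∈ 𝔔^p`, and contract to `𝔓^p`
  have hpow : algebraMap (𝓞 H) (𝓞 E) (u - ξ ^ p) ∈ 𝔔 ^ p := by
    rw [map_sub, map_pow, ← hy]
    exact pow_prime_sub_pow_prime_mem_pow hp 𝔔 hpQ' hyξ
  haveI : 𝔔.IsPrime := inferInstance
  exact (mem_pow_iff_algebraMap_mem_pow_of_ramificationIdx_eq_one 𝔓 𝔔 hP0 hQ0 he p _).mpr hpow

/-- Hecke's necessary condition in the `Algebra.IsUnramifiedAt` packaging of
`KummerPthRootUnramified.lean`: if `𝔔 ∣ 𝔓` is unramified over `𝓞_H` (`p ∈ 𝔓^{p−1}`, `y^p = u`) then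
`u ≡ ξ^p (mod 𝔓^p)` for some `ξ ∈ 𝓞_H`. [cite: Hecke1981, §39 Thm 119] -/
theorem exists_sub_pow_prime_mem_pow_of_isUnramifiedAt {p : ℕ} (hp : p.Prime) {u : 𝓞 H}
    {y : 𝓞 E} (hy : y ^ p = algebraMap (𝓞 H) (𝓞 E) u) (𝔓 : Ideal (𝓞 H)) [𝔓.IsMaximal]
    (hp𝔓 : (p : 𝓞 H) ∈ 𝔓 ^ (p - 1)) (𝔔 : Ideal (𝓞 E)) [𝔔.IsMaximal] [𝔔.LiesOver 𝔓]
    [Algebra.IsUnramifiedAt (𝓞 H) 𝔔] : ∃ ξ : 𝓞 H, u - ξ ^ p ∈ 𝔓 ^ p :=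
  exists_sub_pow_prime_mem_pow_of_ramificationIdx_eq_one hp hy 𝔓 hp𝔓 𝔔
    (Ideal.ramificationIdx_eq_one_iff.mpr inferInstance)

/-- The same with the unramifiedness hypothesis on the prime `𝔓` downstairs
(`Algebra.IsUnramifiedIn (𝓞 E) 𝔓`: every prime of `𝓞_E` above `𝔓` is unramified), using that a
prime above `𝔓` exists.  With `KummerPthRootUnramified.lean` this makes Hecke's criterion an
equivalence for a unit `u` of `ℚ(ζ_p)` (`𝔓 = (1 − ζ_p)`, `(p) = 𝔓^{p−1}`): **`ℚ(ζ_p, ᵖ√u)/ℚ(ζ_p)` is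
unramified iff `u ≡ ξ^p (mod (1 − ζ_p)^p)`**. [cite: Hecke1981, §39 Thm 119] -/
theorem exists_sub_pow_prime_mem_pow_of_isUnramifiedIn {p : ℕ} (hp : p.Prime) {u : 𝓞 H}
    {y : 𝓞 E} (hy : y ^ p = algebraMap (𝓞 H) (𝓞 E) u) (𝔓 : Ideal (𝓞 H)) [𝔓.IsMaximal]
    (hp𝔓 : (p : 𝓞 H) ∈ 𝔓 ^ (p - 1)) (hunr : Algebra.IsUnramifiedIn (𝓞 E) 𝔓) :
    ∃ ξ : 𝓞 H, u - ξ ^ p ∈ 𝔓 ^ p := by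
  obtain ⟨𝔔, h𝔔max, h𝔔over⟩ : ∃ Q : Ideal (𝓞 E), Q.IsMaximal ∧ Q.LiesOver 𝔓 :=
    Ideal.exists_maximal_ideal_liesOver_of_isIntegral 𝔓
  haveI := h𝔔max
  haveI := h𝔔over
  haveI : Algebra.IsUnramifiedAt (𝓞 H) 𝔔 := hunr 𝔔 inferInstance h𝔔over
  exact exists_sub_pow_prime_mem_pow_of_isUnramifiedAt hp hy 𝔓 hp𝔓 𝔔

/-! ### The dictionary `u ≡ ξᵖ (mod 𝔓ᵖ)` ⟺ `u^{q−1} ≡ 1 (mod 𝔓ᵖ)` -/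

/-- If `p ∈ 𝔓^{p−1}` and `ξ ∉ 𝔓`, with `q = #R/𝔓` finite: `ξ^{p(q−1)} ≡ 1 (mod 𝔓^p)` (Fermat in
the residue field, then raise the congruence to the `p`-th power). [folklore] -/
private theorem pow_prime_mul_sub_one_sub_one_mem_pow {R : Type*} [CommRing R] {p : ℕ} (hp : p.Prime)
    (P : Ideal R) [P.IsMaximal] [Finite (R ⧸ P)] (hpP : (p : R) ∈ P ^ (p - 1)) {ξ : R}
    (hξ : ξ ∉ P) : ξ ^ (p * (Nat.card (R ⧸ P) - 1)) - 1 ∈ P ^ p := by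
  classical
  letI := Ideal.Quotient.field P
  haveI : Fintype (R ⧸ P) := Fintype.ofFinite _
  have hunit : (Ideal.Quotient.mk P ξ) ≠ 0 := by
    rwa [Ne, Ideal.Quotient.eq_zero_iff_mem]
  have hF : (Ideal.Quotient.mk P ξ) ^ (Nat.card (R ⧸ P) - 1) = 1 := by
    rw [Nat.card_eq_fintype_card]
    exact FiniteField.pow_card_sub_one_eq_one _ hunit
  have hmem : ξ ^ (Nat.card (R ⧸ P) - 1) - 1 ∈ P := by
    rw [← Ideal.Quotient.eq, map_pow, map_one]
    exact hF
  have := pow_prime_sub_pow_prime_mem_pow hp P hpP hmem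
  rwa [one_pow, ← pow_mul, mul_comm] at this

/-- **`p`-th power modulo `𝔓^p` ⇒ `(q−1)`-st power is `1` modulo `𝔓^p`.**  If `p ∈ 𝔓^{p−1}`,
`u ∉ 𝔓` and `u ≡ ξ^p (mod 𝔓^p)`, then `u^{q−1} ≡ 1 (mod 𝔓^p)`, `q = #R/𝔓` (for `R = ℤ[ζ_p]`,
`𝔓 = (1 − ζ_p)`, `q = p`: `u^{p−1} ≡ 1 (mod λ^p)`). [cite: Washington1997, Thm 5.36 (proof) / Exercise 9.3] -/
theorem pow_sub_one_sub_one_mem_pow_of_sub_pow_prime_mem {R : Type*} [CommRing R] {p : ℕ}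
    (hp : p.Prime) (P : Ideal R) [P.IsMaximal] [Finite (R ⧸ P)] (hpP : (p : R) ∈ P ^ (p - 1))
    {u ξ : R} (hu : u ∉ P) (h : u - ξ ^ p ∈ P ^ p) :
    u ^ (Nat.card (R ⧸ P) - 1) - 1 ∈ P ^ p := by
  have hξ : ξ ∉ P := by
    intro hξP
    apply hu
    have h1 : u - ξ ^ p ∈ P := Ideal.pow_le_self hp.ne_zero h
    have h2 : ξ ^ p ∈ P := P.pow_mem_of_mem hξP p hp.pos
    simpa using P.add_mem h1 h2
  have hdiff : u ^ (Nat.card (R ⧸ P) - 1) - (ξ ^ p) ^ (Nat.card (R ⧸ P) - 1) ∈ P ^ p := by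
    have := Ideal.Quotient.eq.mpr h
    rw [← Ideal.Quotient.eq, map_pow, map_pow, this]
  have hF : (ξ ^ p) ^ (Nat.card (R ⧸ P) - 1) - 1 ∈ P ^ p := by
    have := pow_prime_mul_sub_one_sub_one_mem_pow hp P hpP hξ
    rwa [pow_mul] at this
  have := (P ^ p).add_mem hdiff hF
  convert this using 1
  ring

/-- **`(q−1)`-st power `1` modulo `𝔓^p` ⇒ `p`-th power modulo `𝔓^p`** (the converse; `p ∣ q` is
automatic as `p ∈ 𝔓`): if `u^{q−1} ≡ 1 (mod 𝔓^p)` then `u ≡ (u^{q/p})^p (mod 𝔓^p)`.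
[cite: Washington1997, Thm 5.36 (proof) / Exercise 9.3] -/
theorem sub_pow_prime_mem_pow_of_pow_sub_one {R : Type*} [CommRing R] {p : ℕ} (hp : p.Prime)
    (P : Ideal R) [P.IsMaximal] [Finite (R ⧸ P)] (hpP : (p : R) ∈ P ^ (p - 1)) {u : R}
    (h : u ^ (Nat.card (R ⧸ P) - 1) - 1 ∈ P ^ p) :
    u - (u ^ (Nat.card (R ⧸ P) / p)) ^ p ∈ P ^ p := by
  classical
  letI := Ideal.Quotient.field P
  haveI : Fintype (R ⧸ P) := Fintype.ofFinite _
  have hp1 : p - 1 ≠ 0 := by have := hp.two_le; omega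
  -- the residue field has characteristic `p`, so `q = p^k` with `k ≥ 1`
  have hpP' : (p : R) ∈ P := Ideal.pow_le_self hp1 hpP
  haveI hchar : CharP (R ⧸ P) p := (CharP.charP_iff_prime_eq_zero hp).mpr
    (by rw [← map_natCast (Ideal.Quotient.mk P)]; exact Ideal.Quotient.eq_zero_iff_mem.mpr hpP')
  obtain ⟨k, hk0, hk⟩ : ∃ k : ℕ, k ≠ 0 ∧ Nat.card (R ⧸ P) = p ^ k := by
    haveI := Fact.mk hp
    obtain ⟨n, -, hn⟩ := FiniteField.card (R ⧸ P) p
    exact ⟨n, n.ne_zero, by rw [Nat.card_eq_fintype_card]; exact hn⟩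
  have hqp : Nat.card (R ⧸ P) / p * p = Nat.card (R ⧸ P) := by
    rw [hk]
    obtain ⟨k', rfl⟩ := Nat.exists_eq_succ_of_ne_zero hk0
    rw [pow_succ, Nat.mul_div_cancel _ hp.pos]
  -- `u^q − u = u (u^{q−1} − 1) ∈ P^p`
  have hq1 : 1 ≤ Nat.card (R ⧸ P) := by rw [hk]; exact Nat.one_le_pow _ _ hp.pos
  have key : u - (u ^ (Nat.card (R ⧸ P) / p)) ^ p = -(u * (u ^ (Nat.card (R ⧸ P) - 1) - 1)) := by
    rw [← pow_mul, hqp, mul_sub, mul_one, ← pow_succ', Nat.sub_add_cancel hq1]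
    ring
  rw [key]
  exact (P ^ p).neg_mem (Ideal.mul_mem_left _ _ h)

end Literature.NumberTheory.NumberFields

end
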